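import Literature.Analysis.FluidPDE.KNSSMildBootstrapStep
import HarnessLib

/-!
# Regularity of bounded mild solutions, III: the Oseen operator on smooth data at small times,
# and the Lipschitz dependence (4.11) of the `x`-derivatives on time

Analysis/FluidPDE proofs file (everything proved; no definitions, no named facts) on the discharge
path of `Literature.Analysis.FluidPDE.KNSS2009_mild_regularity` (`KNSSRegularityGalilean`;
Koch–Nadirashvili–Seregin–Šverák, Acta Math. 203 (2009) = arXiv:0709.3599v1, §4): after the
bootstrap (`KNSSMildBootstrapStep.level_all`: `C^∞` slices, uniform bounds (4.10), and the
differentiated mild identities of all orders) this file proves the clause (4.11) of the fact,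
`‖∇ᵏₓ∂ₜ(u − b)‖_{L^∞(ℝⁿ×(δ,T))} ≤ C` in the tree's rendering: **`DᵏV(t)` is Lipschitz in `t` on
`[δ, T)`, uniformly in `x` and in the solution** (`exists_lipschitz_time_iteratedFDeriv`). By the
order-`k` identity between `s < t`,
`DᵏV(t)·m − DᵏV(s)·m = [e^{(t−s)Δ}g − g] − ∫ₛᵗ ∑ᵢ 𝒩_{t−σ}[Tₖᵐ(σ)]ᵢ eᵢ dσ`, `g = DᵏV(s)·m`, and:

* `§ SmallTime` — **the Oseen operator on `C³`-bounded data is bounded uniformly in the clock**: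
  `|𝒩_τ[G]ᵢ(x)| ≤ 8751 B` whenever the components and their directional derivatives up to order
  three are bounded by `B` (`abs_oseenHeat_le_of_chain`).
  In the heat-flow realisation `𝒩_τ G = ∑ⱼ ∂ⱼe^{τΔ}Gⱼᵢ + ∑ⱼₖ ∫₀^∞ ∂ᵢ∂ⱼ∂ₖ e^{(τ+σ)Δ}Gⱼₖ dσ` the
  derivatives fall on the data (`|∂ⱼe^{τΔ}φ| ≤ ‖∂φ‖_∞`, `|∂³e^{sΔ}φ| ≤ ‖∂³φ‖_∞`,
  `abs_heatD3_le_of_chain`), while for `σ ≥ 1` the kernel bound `162(τ+σ)^{-3/2}‖φ‖_∞`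
  takes over; the common majorant `486 B (1 + σ)^{-3/2}` integrates to `972 B`. This is the
  tree's form of KNSS's (3.14) ("a routine inspection of representation formula (3.5) shows
  that … `‖∇ᵏₓuₜ‖ ≤ C(T,k)‖∇ᵏ⁺²ₓf‖`": move derivatives from the kernel to `f` near the
  singularity, use the integrability of `L_{ijk}G` away from it, arXiv p. 6–7), with one more
  derivative on the data than optimal;
* `§ HeatIncrement` — `e^{hΔ}g − g = ∫₀ʰ e^{rΔ}(Δg) dr` for `C²`-bounded `g`, whence
  `‖e^{hΔ}g(x) − g(x)‖ ≤ h · dim E · ‖D²g‖_∞` and the right derivative `Δg(x)` at `h = 0`;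
* `§ TimeLipschitz` — the clause: for each `k`, `δ > 0` a constant `L_k(δ)` (depending on
  `k, N, T, δ`) with `‖DᵏV(t)(x) − DᵏV(s)(x)‖ ≤ L_k(δ)|t − s|` for `s, t ∈ [δ, T)`; and the
  consequences used by the vorticity file: continuity in time of `DᵏV(·)(x)` and joint
  continuity of `(t, x) ↦ DᵏV(t)(x)` on `(0, T) × E`.

Everything is in the sub-namespace `KNSSBootstrap`.

## References

* G. Koch, N. Nadirashvili, G. Seregin, V. Šverák, *Liouville theorems for the Navier–Stokes
  equations and applications*, Acta Math. 203 (2009) 83–105 = arXiv:0709.3599v1: §3 (3.14)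
  and its sketch (pp. 6–7); §4 (4.11) (p. 8). [KochNadirashviliSereginSverak2009]
-/

noncomputable section

open MeasureTheory Set Function Filter TopologicalSpace InnerProductSpace Metric
open _root_.Topology
open scoped RealInnerProductSpace NNReal ENNReal Interval Laplacian

namespace Literature.Analysis.FluidPDE

namespace KNSSBootstrap

variable {E : Type*} [NormedAddCommGroup E] [InnerProductSpace ℝ E] [FiniteDimensional ℝ E]
  [MeasurableSpace E] [BorelSpace E]

/-! ### The Oseen operator on `C³`-bounded data: bounds uniform in the clock -/

section SmallTime

/-! The data are described through a **directional chain**: a scalar function `φ` together with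
its first, second and third directional derivatives `φ₁ w = ∂_wφ`, `φ₂ v w = ∂ᵥ∂_wφ`,
`φ₃ u v w = ∂ᵤ∂ᵥ∂_wφ` as explicit functions, each of the first three levels being `C¹` and
all four bounded by `B` at vectors of norm `≤ 1`. This is the form in which the level tensors of
the bootstrap come (their directional derivatives are level tensors of the next order,
`levelTensor_contDiff_one`), and it avoids any bookkeeping of iterated derivatives. -/

variable {φ : E → ℝ} {φ₁ : E → E → ℝ} {φ₂ : E → E → E → ℝ} {φ₃ : E → E → E → E → ℝ} {B : ℝ}

/-- **Derivatives fall on the data, bound for `D³e^{sΔ}`**: along a directional chain bounded by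
`B`, `|∂ᵤ∂ᵥ∂_w e^{sΔ}φ(x)| ≤ B` for `s > 0` and `‖u‖, ‖v‖, ‖w‖ ≤ 1`
(`heatD3 s u v w φ = e^{sΔ}(φ₃ u v w)` by three applications of
`fderiv_heatExtension_apply_of_bounded`, then `‖e^{sΔ}g‖ ≤ ‖g‖_∞`). [folklore] -/
theorem abs_heatD3_le_of_chain (h0 : ContDiff ℝ 1 φ) (hb0 : ∀ y, |φ y| ≤ B)
    (h1 : ∀ w, ContDiff ℝ 1 (φ₁ w)) (hd1 : ∀ w y, fderiv ℝ φ y w = φ₁ w y)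
    (hb1 : ∀ w, ‖w‖ ≤ 1 → ∀ y, |φ₁ w y| ≤ B)
    (h2 : ∀ v w, ContDiff ℝ 1 (φ₂ v w)) (hd2 : ∀ v w y, fderiv ℝ (φ₁ w) y v = φ₂ v w y)
    (hb2 : ∀ v w, ‖v‖ ≤ 1 → ‖w‖ ≤ 1 → ∀ y, |φ₂ v w y| ≤ B)
    (hd3 : ∀ u v w y, fderiv ℝ (φ₂ v w) y u = φ₃ u v w y)
    (hb3 : ∀ u v w, ‖u‖ ≤ 1 → ‖v‖ ≤ 1 → ‖w‖ ≤ 1 → ∀ y, |φ₃ u v w y| ≤ B)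
    {s : ℝ} (hs : 0 < s) {u v w : E} (hu : ‖u‖ ≤ 1) (hv : ‖v‖ ≤ 1) (hw : ‖w‖ ≤ 1) (x : E) :
    |heatD3 s u v w φ x| ≤ B := by
  have hb0' : ∀ z, ‖φ z‖ ≤ B := fun z => by rw [Real.norm_eq_abs]; exact hb0 z
  have hb1' : ∀ z, ‖fderiv ℝ φ z w‖ ≤ B := fun z => by
    rw [hd1 w z, Real.norm_eq_abs]; exact hb1 w hw z
  have hb1'' : ∀ z, ‖φ₁ w z‖ ≤ B := fun z => by rw [Real.norm_eq_abs]; exact hb1 w hw z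
  have hb2' : ∀ z, ‖fderiv ℝ (φ₁ w) z v‖ ≤ B := fun z => by
    rw [hd2 v w z, Real.norm_eq_abs]; exact hb2 v w hv hw z
  have hb2'' : ∀ z, ‖φ₂ v w z‖ ≤ B := fun z => by rw [Real.norm_eq_abs]; exact hb2 v w hv hw z
  have hb3' : ∀ z, ‖fderiv ℝ (φ₂ v w) z u‖ ≤ B := fun z => by
    rw [hd3 u v w z, Real.norm_eq_abs]; exact hb3 u v w hu hv hw z
  -- the three commutations
  have e1 : (fun y => fderiv ℝ (UnboundedOperators.heatExtension φ s) y w) =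
      UnboundedOperators.heatExtension (φ₁ w) s := by
    funext y
    rw [UnboundedOperators.fderiv_heatExtension_apply_of_bounded h0 hb0' hb1' hs y]
    congr 1
    funext z
    exact hd1 w z
  have e2 : (fun y => fderiv ℝ (UnboundedOperators.heatExtension (φ₁ w) s) y v) =
      UnboundedOperators.heatExtension (φ₂ v w) s := by
    funext y
    rw [UnboundedOperators.fderiv_heatExtension_apply_of_bounded (h1 w) hb1'' hb2' hs y]
    congr 1
    funext z
    exact hd2 v w z
  have e3 : fderiv ℝ (UnboundedOperators.heatExtension (φ₂ v w) s) x u =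
      UnboundedOperators.heatExtension (fun z => fderiv ℝ (φ₂ v w) z u) s x :=
    UnboundedOperators.fderiv_heatExtension_apply_of_bounded (h2 v w) hb2'' hb3' hs x
  unfold heatD3
  rw [e1, e2, e3, ← Real.norm_eq_abs]
  exact UnboundedOperators.norm_heatExtension_le hb3' hs x

/-- **Derivatives fall on the data, bound for `De^{sΔ}`**: `|∂ᵥe^{sΔ}φ(x)| ≤ B` for `‖v‖ ≤ 1`
when `|φ| ≤ B` and `|∂ᵥφ| = |φ₁ v| ≤ B`. [folklore] -/
theorem abs_heatD1_le_of_chain (h0 : ContDiff ℝ 1 φ) (hb0 : ∀ y, |φ y| ≤ B)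
    (hd1 : ∀ w y, fderiv ℝ φ y w = φ₁ w y) (hb1 : ∀ w, ‖w‖ ≤ 1 → ∀ y, |φ₁ w y| ≤ B)
    {s : ℝ} (hs : 0 < s) {v : E} (hv : ‖v‖ ≤ 1) (x : E) : |heatD1 s v φ x| ≤ B := by
  have hb0' : ∀ z, ‖φ z‖ ≤ B := fun z => by rw [Real.norm_eq_abs]; exact hb0 z
  have hb1' : ∀ z, ‖fderiv ℝ φ z v‖ ≤ B := fun z => by
    rw [hd1 v z, Real.norm_eq_abs]; exact hb1 v hv z
  unfold heatD1
  rw [UnboundedOperators.fderiv_heatExtension_apply_of_bounded h0 hb0' hb1' hs x, ← Real.norm_eq_abs]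
  exact UnboundedOperators.norm_heatExtension_le hb1' hs x

omit [FiniteDimensional ℝ E] [MeasurableSpace E] [BorelSpace E] in
/-- `1 ≤ 3 (1 + σ)^{-3/2}` for `0 ≤ σ ≤ 1`. [folklore] -/
theorem one_le_three_mul_rpow_one_add {σ : ℝ} (hσ0 : 0 ≤ σ) (hσ1 : σ ≤ 1) :
    (1 : ℝ) ≤ 3 * (1 + σ) ^ (-(3 / 2 : ℝ)) := by
  have h1 : (1 + σ) ^ (-(3 / 2 : ℝ)) ≥ (2 : ℝ) ^ (-(3 / 2 : ℝ)) :=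
    Real.rpow_le_rpow_of_nonpos (by linarith) (by linarith) (by norm_num)
  have h2 : (2 : ℝ) ^ (-(3 / 2 : ℝ)) ≥ 1 / 3 := by
    rw [Real.rpow_neg (by norm_num), ge_iff_le, one_div,
      inv_le_inv₀ (by norm_num) (Real.rpow_pos_of_pos (by norm_num) _)]
    exact two_rpow_three_halves_le_three
  linarith

omit [FiniteDimensional ℝ E] [MeasurableSpace E] [BorelSpace E] in
/-- For `σ ≥ 1` and `τ > 0`: `(τ + σ)^{-3/2} ≤ 3 (1 + σ)^{-3/2}`. [folklore] -/
theorem rpow_add_le_three_mul_rpow_one_add {τ σ : ℝ} (hτ : 0 < τ) (hσ1 : 1 ≤ σ) :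
    (τ + σ) ^ (-(3 / 2 : ℝ)) ≤ 3 * (1 + σ) ^ (-(3 / 2 : ℝ)) := by
  have hσ0 : 0 < σ := by linarith
  have h1 : (τ + σ) ^ (-(3 / 2 : ℝ)) ≤ σ ^ (-(3 / 2 : ℝ)) :=
    Real.rpow_le_rpow_of_nonpos hσ0 (by linarith) (by norm_num)
  have h3 : σ ^ (-(3 / 2 : ℝ)) ≤ ((1 + σ) / 2) ^ (-(3 / 2 : ℝ)) :=
    Real.rpow_le_rpow_of_nonpos (by positivity) (by linarith) (by norm_num)
  have h4 : ((1 + σ) / 2) ^ (-(3 / 2 : ℝ)) = (2 : ℝ) ^ (3 / 2 : ℝ) * (1 + σ) ^ (-(3 / 2 : ℝ)) := by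
    rw [Real.div_rpow (by linarith) (by norm_num), Real.rpow_neg (by norm_num : (0:ℝ) ≤ 2),
      div_inv_eq_mul, mul_comm]
  have h5 : (2 : ℝ) ^ (3 / 2 : ℝ) * (1 + σ) ^ (-(3 / 2 : ℝ)) ≤ 3 * (1 + σ) ^ (-(3 / 2 : ℝ)) :=
    mul_le_mul_of_nonneg_right two_rpow_three_halves_le_three (Real.rpow_nonneg (by linarith) _)
  linarith

variable (hE : Module.finrank ℝ E = 3)
include hE

/-- **The Leray-correction integrand on `C³`-bounded data** has the clock-uniform majorant
`486 B (1 + σ)^{-3/2}` on `σ > 0`: `B` from the derivatives on the data for `σ ≤ 1`, and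
`162(τ+σ)^{-3/2}B ≤ 486 B (1+σ)^{-3/2}` from the kernel for `σ ≥ 1`. [folklore] -/
theorem abs_heatD3_const_add_le_majorant (h0 : ContDiff ℝ 1 φ) (hb0 : ∀ y, |φ y| ≤ B)
    (h1 : ∀ w, ContDiff ℝ 1 (φ₁ w)) (hd1 : ∀ w y, fderiv ℝ φ y w = φ₁ w y)
    (hb1 : ∀ w, ‖w‖ ≤ 1 → ∀ y, |φ₁ w y| ≤ B)
    (h2 : ∀ v w, ContDiff ℝ 1 (φ₂ v w)) (hd2 : ∀ v w y, fderiv ℝ (φ₁ w) y v = φ₂ v w y)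
    (hb2 : ∀ v w, ‖v‖ ≤ 1 → ‖w‖ ≤ 1 → ∀ y, |φ₂ v w y| ≤ B)
    (hd3 : ∀ u v w y, fderiv ℝ (φ₂ v w) y u = φ₃ u v w y)
    (hb3 : ∀ u v w, ‖u‖ ≤ 1 → ‖v‖ ≤ 1 → ‖w‖ ≤ 1 → ∀ y, |φ₃ u v w y| ≤ B)
    (hB0 : 0 ≤ B) {τ : ℝ} (hτ : 0 < τ)
    (i j k : Fin (Module.finrank ℝ E)) (x : E) {σ : ℝ} (hσ : 0 < σ) :
    |heatD3 (τ + σ) (stdOrthonormalBasis ℝ E i) (stdOrthonormalBasis ℝ E j)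
        (stdOrthonormalBasis ℝ E k) φ x| ≤ 486 * B * (1 + σ) ^ (-(3 / 2 : ℝ)) := by
  have hn := fun l => norm_stdOrthonormalBasis_le_one (E := E) l
  rcases le_or_gt σ 1 with hσ1 | hσ1
  · have h1 := abs_heatD3_le_of_chain h0 hb0 h1 hd1 hb1 h2 hd2 hb2 hd3 hb3 (by linarith : 0 < τ + σ)
      (hn i) (hn j) (hn k) x
    have h2 := one_le_three_mul_rpow_one_add hσ.le hσ1
    nlinarith [Real.rpow_nonneg (by linarith : (0:ℝ) ≤ 1 + σ) (-(3 / 2 : ℝ))]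
  · have hb0' : ∀ z, ‖φ z‖ ≤ B := fun z => by rw [Real.norm_eq_abs]; exact hb0 z
    have hφm : MemLp φ ∞ volume :=
      memLp_top_of_bound h0.continuous.aestronglyMeasurable B (Eventually.of_forall hb0')
    have hsn : (eLpNorm φ ∞ volume).toReal ≤ B := by
      have h1 : eLpNorm φ ∞ volume ≤ ENNReal.ofReal B := by
        rw [eLpNorm_exponent_top]; exact eLpNormEssSup_le_of_ae_bound (Eventually.of_forall hb0')
      exact ENNReal.toReal_le_of_le_ofReal hB0 h1
    have h1 := norm_heatD3_le_of_top hE hφm (by linarith : 0 < τ + σ) i j k x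
    rw [Real.norm_eq_abs] at h1
    have h2 := rpow_add_le_three_mul_rpow_one_add hτ hσ1.le
    have h3 : 0 ≤ (τ + σ) ^ (-(3 / 2 : ℝ)) := Real.rpow_nonneg (by linarith) _
    calc |heatD3 (τ + σ) (stdOrthonormalBasis ℝ E i) (stdOrthonormalBasis ℝ E j)
          (stdOrthonormalBasis ℝ E k) φ x|
        ≤ 162 * (τ + σ) ^ (-(3 / 2 : ℝ)) * (eLpNorm φ ∞ volume).toReal := h1
      _ ≤ 162 * (3 * (1 + σ) ^ (-(3 / 2 : ℝ))) * B := by gcongr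
      _ = 486 * B * (1 + σ) ^ (-(3 / 2 : ℝ)) := by ring

omit [NormedAddCommGroup E] [InnerProductSpace ℝ E] [FiniteDimensional ℝ E] [MeasurableSpace E]
  [BorelSpace E] hE in
/-- `∫₀^∞ 486 B (1 + σ)^{-3/2} dσ = 972 B`. [folklore] -/
theorem integral_majorant_eq (hB0 : 0 ≤ B) :
    ∫ σ in Ioi (0 : ℝ), 486 * B * (1 + σ) ^ (-(3 / 2 : ℝ)) = 972 * B := by
  have hnn : 0 ≤ᵐ[volume.restrict (Ioi (0 : ℝ))] fun σ => 486 * B * (1 + σ) ^ (-(3 / 2 : ℝ)) :=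
    (ae_restrict_iff' measurableSet_Ioi).2 (Eventually.of_forall fun σ hσ => by
      have : (0 : ℝ) < σ := hσ
      positivity)
  have hm : AEStronglyMeasurable (fun σ : ℝ => 486 * B * (1 + σ) ^ (-(3 / 2 : ℝ)))
      (volume.restrict (Ioi (0 : ℝ))) :=
    (integrableOn_const_mul_rpow_const_add one_pos (by norm_num : (1 : ℝ) < 3 / 2) (486 * B)).aestronglyMeasurable
  rw [integral_eq_lintegral_of_nonneg_ae hnn hm,
    lintegral_Ioi_ofReal_mul_rpow_add (by positivity : (0 : ℝ) ≤ 486 * B) (by norm_num) one_pos,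
    ENNReal.toReal_ofReal (by norm_num; positivity)]
  norm_num
  ring

/-- **The Leray correction of `C³`-bounded data is bounded uniformly in the clock**:
`|∫₀^∞ ∂ᵢ∂ⱼ∂ₖ e^{(τ+σ)Δ}φ(x) dσ| ≤ 972 B`. [folklore] -/
theorem abs_integral_Ioi_heatD3_le_of_chain (h0 : ContDiff ℝ 1 φ) (hb0 : ∀ y, |φ y| ≤ B)
    (h1 : ∀ w, ContDiff ℝ 1 (φ₁ w)) (hd1 : ∀ w y, fderiv ℝ φ y w = φ₁ w y)
    (hb1 : ∀ w, ‖w‖ ≤ 1 → ∀ y, |φ₁ w y| ≤ B)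
    (h2 : ∀ v w, ContDiff ℝ 1 (φ₂ v w)) (hd2 : ∀ v w y, fderiv ℝ (φ₁ w) y v = φ₂ v w y)
    (hb2 : ∀ v w, ‖v‖ ≤ 1 → ‖w‖ ≤ 1 → ∀ y, |φ₂ v w y| ≤ B)
    (hd3 : ∀ u v w y, fderiv ℝ (φ₂ v w) y u = φ₃ u v w y)
    (hb3 : ∀ u v w, ‖u‖ ≤ 1 → ‖v‖ ≤ 1 → ‖w‖ ≤ 1 → ∀ y, |φ₃ u v w y| ≤ B)
    (hB0 : 0 ≤ B) {τ : ℝ} (hτ : 0 < τ) (i j k : Fin (Module.finrank ℝ E)) (x : E) :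
    |∫ σ in Ioi (0 : ℝ), heatD3 (τ + σ) (stdOrthonormalBasis ℝ E i) (stdOrthonormalBasis ℝ E j)
        (stdOrthonormalBasis ℝ E k) φ x| ≤ 972 * B := by
  rw [← Real.norm_eq_abs, ← integral_majorant_eq hB0]
  refine norm_integral_le_of_norm_le
    (integrableOn_const_mul_rpow_const_add one_pos (by norm_num : (1 : ℝ) < 3 / 2) (486 * B)) ?_
  refine (ae_restrict_iff' measurableSet_Ioi).2 (Eventually.of_forall fun σ hσ => ?_)
  rw [Real.norm_eq_abs]
  exact abs_heatD3_const_add_le_majorant hE h0 hb0 h1 hd1 hb1 h2 hd2 hb2 hd3 hb3 hB0 hτ i j k x hσ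

variable {G : Fin (Module.finrank ℝ E) → Fin (Module.finrank ℝ E) → E → ℝ}
  {G₁ : Fin (Module.finrank ℝ E) → Fin (Module.finrank ℝ E) → E → E → ℝ}
  {G₂ : Fin (Module.finrank ℝ E) → Fin (Module.finrank ℝ E) → E → E → E → ℝ}
  {G₃ : Fin (Module.finrank ℝ E) → Fin (Module.finrank ℝ E) → E → E → E → E → ℝ}

/-- **The Oseen operator on `C³`-bounded data is bounded uniformly in the clock**: if every
component `Gⱼₖ` carries a directional chain bounded by `B`, then `|𝒩_τ[G]ᵢ(x)| ≤ 8751 B` for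
every `τ > 0` (`3 B` from the divergence part, `9 · 972 B` from the Leray correction) — the
tree's form of KNSS's time-derivative estimate (3.14) at the level of the representation formula.
[cite: KochNadirashviliSereginSverak2009, §3 (3.14) and its sketch (arXiv:0709.3599v1 pp. 6–7)] -/
theorem abs_oseenHeat_le_of_chain
    (h0 : ∀ j k, ContDiff ℝ 1 (G j k)) (hb0 : ∀ j k y, |G j k y| ≤ B)
    (h1 : ∀ j k w, ContDiff ℝ 1 (G₁ j k w)) (hd1 : ∀ j k w y, fderiv ℝ (G j k) y w = G₁ j k w y)
    (hb1 : ∀ j k w, ‖w‖ ≤ 1 → ∀ y, |G₁ j k w y| ≤ B)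
    (h2 : ∀ j k v w, ContDiff ℝ 1 (G₂ j k v w))
    (hd2 : ∀ j k v w y, fderiv ℝ (G₁ j k w) y v = G₂ j k v w y)
    (hb2 : ∀ j k v w, ‖v‖ ≤ 1 → ‖w‖ ≤ 1 → ∀ y, |G₂ j k v w y| ≤ B)
    (hd3 : ∀ j k u v w y, fderiv ℝ (G₂ j k v w) y u = G₃ j k u v w y)
    (hb3 : ∀ j k u v w, ‖u‖ ≤ 1 → ‖v‖ ≤ 1 → ‖w‖ ≤ 1 → ∀ y, |G₃ j k u v w y| ≤ B)
    (hB0 : 0 ≤ B) {τ : ℝ} (hτ : 0 < τ) (i : Fin (Module.finrank ℝ E)) (x : E) :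
    |oseenHeat τ G i x| ≤ 8751 * B := by
  have hn := fun l => norm_stdOrthonormalBasis_le_one (E := E) l
  have hD1 : ∀ j, |heatD1 τ (stdOrthonormalBasis ℝ E j) (G j i) x| ≤ B := fun j =>
    abs_heatD1_le_of_chain (h0 j i) (hb0 j i) (hd1 j i) (hb1 j i) hτ (hn j) x
  have hD3 : ∀ j k, |∫ σ in Ioi (0 : ℝ), heatD3 (τ + σ) (stdOrthonormalBasis ℝ E i)
      (stdOrthonormalBasis ℝ E j) (stdOrthonormalBasis ℝ E k) (G j k) x| ≤ 972 * B := fun j k =>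
    abs_integral_Ioi_heatD3_le_of_chain hE (h0 j k) (hb0 j k) (h1 j k) (hd1 j k) (hb1 j k)
      (h2 j k) (hd2 j k) (hb2 j k) (hd3 j k) (hb3 j k) hB0 hτ i j k x
  unfold oseenHeat
  refine (abs_add_le _ _).trans ?_
  have hs1 : |∑ j, heatD1 τ (stdOrthonormalBasis ℝ E j) (G j i) x| ≤ 3 * B := by
    refine (Finset.abs_sum_le_sum_abs _ _).trans ?_
    calc ∑ j, |heatD1 τ (stdOrthonormalBasis ℝ E j) (G j i) x|
        ≤ ∑ _j : Fin (Module.finrank ℝ E), B := Finset.sum_le_sum fun j _ => hD1 j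
      _ = 3 * B := sum_const_fin_finrank hE B
  have hs3 : |∑ j, ∑ k, ∫ σ in Ioi (0 : ℝ), heatD3 (τ + σ) (stdOrthonormalBasis ℝ E i)
      (stdOrthonormalBasis ℝ E j) (stdOrthonormalBasis ℝ E k) (G j k) x| ≤ 3 * (3 * (972 * B)) := by
    refine (Finset.abs_sum_le_sum_abs _ _).trans ?_
    calc ∑ j, |∑ k, ∫ σ in Ioi (0 : ℝ), heatD3 (τ + σ) (stdOrthonormalBasis ℝ E i)
          (stdOrthonormalBasis ℝ E j) (stdOrthonormalBasis ℝ E k) (G j k) x|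
        ≤ ∑ _j : Fin (Module.finrank ℝ E), 3 * (972 * B) := by
          refine Finset.sum_le_sum fun j _ => (Finset.abs_sum_le_sum_abs _ _).trans ?_
          calc ∑ k, |∫ σ in Ioi (0 : ℝ), heatD3 (τ + σ) (stdOrthonormalBasis ℝ E i)
                (stdOrthonormalBasis ℝ E j) (stdOrthonormalBasis ℝ E k) (G j k) x|
              ≤ ∑ _k : Fin (Module.finrank ℝ E), 972 * B := Finset.sum_le_sum fun k _ => hD3 j k
            _ = 3 * (972 * B) := sum_const_fin_finrank hE _
      _ = 3 * (3 * (972 * B)) := sum_const_fin_finrank hE _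
  linarith

/-- Vector form: `‖∑ᵢ 𝒩_τ[G]ᵢ(x) eᵢ‖ ≤ 26253 B` (`3 · 8751`). [folklore] -/
theorem norm_sum_oseenHeat_smul_le_of_chain
    (h0 : ∀ j k, ContDiff ℝ 1 (G j k)) (hb0 : ∀ j k y, |G j k y| ≤ B)
    (h1 : ∀ j k w, ContDiff ℝ 1 (G₁ j k w)) (hd1 : ∀ j k w y, fderiv ℝ (G j k) y w = G₁ j k w y)
    (hb1 : ∀ j k w, ‖w‖ ≤ 1 → ∀ y, |G₁ j k w y| ≤ B)
    (h2 : ∀ j k v w, ContDiff ℝ 1 (G₂ j k v w))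
    (hd2 : ∀ j k v w y, fderiv ℝ (G₁ j k w) y v = G₂ j k v w y)
    (hb2 : ∀ j k v w, ‖v‖ ≤ 1 → ‖w‖ ≤ 1 → ∀ y, |G₂ j k v w y| ≤ B)
    (hd3 : ∀ j k u v w y, fderiv ℝ (G₂ j k v w) y u = G₃ j k u v w y)
    (hb3 : ∀ j k u v w, ‖u‖ ≤ 1 → ‖v‖ ≤ 1 → ‖w‖ ≤ 1 → ∀ y, |G₃ j k u v w y| ≤ B)
    (hB0 : 0 ≤ B) {τ : ℝ} (hτ : 0 < τ) (x : E) :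
    ‖∑ i, oseenHeat τ G i x • stdOrthonormalBasis ℝ E i‖ ≤ 26253 * B := by
  refine (norm_sum_smul_stdOrthonormalBasis_le _).trans ?_
  calc ∑ i, |oseenHeat τ G i x| ≤ ∑ _i : Fin (Module.finrank ℝ E), 8751 * B :=
        Finset.sum_le_sum fun i _ =>
          abs_oseenHeat_le_of_chain hE h0 hb0 h1 hd1 hb1 h2 hd2 hb2 hd3 hb3 hB0 hτ i x
    _ = 3 * (8751 * B) := sum_const_fin_finrank hE _
    _ = 26253 * B := by ring

end SmallTime

/-! ### Evaluated iterated derivatives as `C²`-bounded data -/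

section EvalData

variable {F : Type*} [NormedAddCommGroup F] [NormedSpace ℝ F]

omit [InnerProductSpace ℝ E] [FiniteDimensional ℝ E] [MeasurableSpace E] [BorelSpace E] in
/-- `∏ᵢ ‖(w, m)ᵢ‖ = ‖w‖ ∏ᵢ ‖mᵢ‖` for a `cons`-tuple. [folklore] -/
theorem prod_norm_cons {k : ℕ} (w : E) (m : Fin k → E) :
    ∏ i, ‖(Fin.cons w m : Fin (k + 1) → E) i‖ = ‖w‖ * ∏ i, ‖m i‖ := by
  rw [Fin.prod_univ_succ]
  simp only [Fin.cons_zero, Fin.cons_succ]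

omit [MeasurableSpace E] [BorelSpace E] in
/-- **The evaluated `k`-th derivative `g = Dᵏf·m` of a `Cᵏ⁺²` map with `‖Dʲf‖ ≤ A` is
`C²`-bounded**: `g ∈ C²`, `‖g‖, ‖Dg‖, ‖D²g‖ ≤ A∏‖mᵢ‖` and `‖Δg‖ ≤ dim E · A∏‖mᵢ‖`, with the
explicit first and second derivatives `Dg(y)·w = Dᵏ⁺¹f(y)(w, m)`,
`D²g(y)(a)(b) = Dᵏ⁺²f(y)(a, b, m)`. [folklore] -/
theorem evalData_bounds {f : E → F} {k : ℕ} (hf : ContDiff ℝ (k + 2) f) {A : ℝ} (hA : 0 ≤ A)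
    (hbd : ∀ j ≤ k + 2, ∀ y, ‖iteratedFDeriv ℝ j f y‖ ≤ A) (m : Fin k → E) :
    ContDiff ℝ 2 (fun y => iteratedFDeriv ℝ k f y m) ∧
    (∀ y, ‖iteratedFDeriv ℝ k f y m‖ ≤ A * ∏ i, ‖m i‖) ∧
    (∀ y w, fderiv ℝ (fun y => iteratedFDeriv ℝ k f y m) y w = iteratedFDeriv ℝ (k + 1) f y (Fin.cons w m)) ∧
    (∀ y, ‖fderiv ℝ (fun y => iteratedFDeriv ℝ k f y m) y‖ ≤ A * ∏ i, ‖m i‖) ∧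
    (∀ y a b, fderiv ℝ (fderiv ℝ (fun y => iteratedFDeriv ℝ k f y m)) y a b =
      iteratedFDeriv ℝ (k + 2) f y (Fin.cons a (Fin.cons b m))) ∧
    (∀ y, ‖fderiv ℝ (fderiv ℝ (fun y => iteratedFDeriv ℝ k f y m)) y‖ ≤ A * ∏ i, ‖m i‖) ∧
    (∀ y, ‖(Δ (fun y => iteratedFDeriv ℝ k f y m)) y‖ ≤ Module.finrank ℝ E * (A * ∏ i, ‖m i‖)) := by
  set P : ℝ := ∏ i, ‖m i‖ with hP
  have hP0 : 0 ≤ P := Finset.prod_nonneg fun i _ => norm_nonneg _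
  set g : E → F := fun y => iteratedFDeriv ℝ k f y m with hg
  set ev := ContinuousMultilinearMap.apply ℝ (fun _ : Fin k => E) F m with hev
  have hcomp : g = ev ∘ iteratedFDeriv ℝ k f := rfl
  have hg2 : ContDiff ℝ 2 g := by
    rw [hcomp]
    exact ev.contDiff.comp (hf.iteratedFDeriv_right (m := 2) (i := k) (by rw [add_comm]))
  have hdk : ∀ y, DifferentiableAt ℝ (iteratedFDeriv ℝ k f) y := fun y =>
    (hf.differentiable_iteratedFDeriv (by exact_mod_cast (by omega : k < k + 2))) y
  have hdk1 : ∀ y, DifferentiableAt ℝ (iteratedFDeriv ℝ (k + 1) f) y := fun y =>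
    (hf.differentiable_iteratedFDeriv (by exact_mod_cast (by omega : k + 1 < k + 2))) y
  -- first derivative
  have hD1 : ∀ y w, fderiv ℝ g y w = iteratedFDeriv ℝ (k + 1) f y (Fin.cons w m) := fun y w =>
    ((hdk y).iteratedFDeriv_succ_apply_left' (m := Fin.cons w m)).symm
  have hb0 : ∀ y, ‖g y‖ ≤ A * P := fun y =>
    (ContinuousMultilinearMap.le_opNorm _ _).trans (mul_le_mul_of_nonneg_right (hbd k (by omega) y) hP0)
  have hb1 : ∀ y, ‖fderiv ℝ g y‖ ≤ A * P := by
    intro y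
    refine ContinuousLinearMap.opNorm_le_bound _ (mul_nonneg hA hP0) fun w => ?_
    rw [hD1 y w]
    refine (ContinuousMultilinearMap.le_opNorm _ _).trans ?_
    rw [prod_norm_cons]
    calc ‖iteratedFDeriv ℝ (k + 1) f y‖ * (‖w‖ * P) ≤ A * (‖w‖ * P) :=
          mul_le_mul_of_nonneg_right (hbd (k + 1) (by omega) y) (mul_nonneg (norm_nonneg _) hP0)
      _ = A * P * ‖w‖ := by ring
  -- second derivative
  have hg1d : ∀ y, DifferentiableAt ℝ (fderiv ℝ g) y := fun y =>
    ((hg2.fderiv_right (m := 1) (by norm_num)).differentiable one_ne_zero) y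
  have hD2 : ∀ y a b, fderiv ℝ (fderiv ℝ g) y a b = iteratedFDeriv ℝ (k + 2) f y (Fin.cons a (Fin.cons b m)) := by
    intro y a b
    have h1 : fderiv ℝ (fderiv ℝ g) y a b = fderiv ℝ (fun y => fderiv ℝ g y b) y a := by
      rw [fderiv_clm_apply (hg1d y) (differentiableAt_const b)]
      simp
    have h2 : (fun y => fderiv ℝ g y b) = fun y => iteratedFDeriv ℝ (k + 1) f y (Fin.cons b m) :=
      funext fun y => hD1 y b
    rw [h1, h2]
    exact ((hdk1 y).iteratedFDeriv_succ_apply_left' (m := Fin.cons a (Fin.cons b m))).symm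
  have hb2 : ∀ y, ‖fderiv ℝ (fderiv ℝ g) y‖ ≤ A * P := by
    intro y
    refine ContinuousLinearMap.opNorm_le_bound _ (mul_nonneg hA hP0) fun a => ?_
    refine ContinuousLinearMap.opNorm_le_bound _ (by positivity) fun b => ?_
    rw [hD2 y a b]
    refine (ContinuousMultilinearMap.le_opNorm _ _).trans ?_
    rw [prod_norm_cons, prod_norm_cons]
    calc ‖iteratedFDeriv ℝ (k + 2) f y‖ * (‖a‖ * (‖b‖ * P)) ≤ A * (‖a‖ * (‖b‖ * P)) :=
          mul_le_mul_of_nonneg_right (hbd (k + 2) le_rfl y) (by positivity)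
      _ = A * P * ‖a‖ * ‖b‖ := by ring
  -- the Laplacian
  have hΔ : ∀ y, ‖(Δ g) y‖ ≤ Module.finrank ℝ E * (A * P) := by
    intro y
    rw [laplacian_eq_iteratedFDeriv_stdOrthonormalBasis g]
    refine (norm_sum_le _ _).trans ?_
    have hterm : ∀ i, ‖iteratedFDeriv ℝ 2 g y ![stdOrthonormalBasis ℝ E i, stdOrthonormalBasis ℝ E i]‖ ≤ A * P := by
      intro i
      rw [iteratedFDeriv_two_apply]
      simp only [Matrix.cons_val_zero, Matrix.cons_val_one]
      rw [hD2 y]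
      refine (ContinuousMultilinearMap.le_opNorm _ _).trans ?_
      rw [prod_norm_cons, prod_norm_cons, (stdOrthonormalBasis ℝ E).orthonormal.1 i, one_mul, one_mul]
      exact mul_le_mul_of_nonneg_right (hbd (k + 2) le_rfl y) hP0
    calc ∑ i, ‖iteratedFDeriv ℝ 2 g y ![stdOrthonormalBasis ℝ E i, stdOrthonormalBasis ℝ E i]‖
        ≤ ∑ _i : Fin (Module.finrank ℝ E), A * P := Finset.sum_le_sum fun i _ => hterm i
      _ = Module.finrank ℝ E * (A * P) := by
          rw [Finset.sum_const, Finset.card_univ, Fintype.card_fin, nsmul_eq_mul]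
  exact ⟨hg2, hb0, hD1, hb1, hD2, hb2, hΔ⟩

end EvalData

/-! ### The increment of the heat flow on `C²`-bounded data -/

section HeatIncrement

variable {F : Type*} [NormedAddCommGroup F] [NormedSpace ℝ F] [CompleteSpace F]

omit [CompleteSpace F] in
/-- The caloric extension of the (bounded, continuous) Laplacian of `C²`-bounded data is bounded
by `‖Δg‖_∞` and interval integrable in the time from `0`. [folklore] -/
theorem intervalIntegrable_heatExtension_laplacian {g : E → F} (hg : ContDiff ℝ 2 g)
    {CΔ : ℝ} (hΔ : ∀ z, ‖(Δ g) z‖ ≤ CΔ) (x : E) {c : ℝ} (hc : 0 ≤ c) :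
    IntervalIntegrable (fun r => UnboundedOperators.heatExtension (Δ g) r x) volume 0 c := by
  have hΔc : Continuous (Δ g) := continuous_laplacian_of_contDiff hg
  have hΔm : MemLp (Δ g) ∞ volume :=
    memLp_top_of_bound hΔc.aestronglyMeasurable CΔ (Eventually.of_forall hΔ)
  rw [intervalIntegrable_iff_integrableOn_Ioc_of_le hc]
  have hcont : ContinuousOn (fun r => UnboundedOperators.heatExtension (Δ g) r x) (Ioi 0) :=
    UnboundedOperators.continuousOn_heatExtension_time hΔm le_top x
  have hmeas : AEStronglyMeasurable (fun r => UnboundedOperators.heatExtension (Δ g) r x)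
      (volume.restrict (Ioc 0 c)) :=
    (hcont.mono fun r hr => hr.1).aestronglyMeasurable measurableSet_Ioc
  refine Integrable.mono' (continuous_const.integrableOn_Ioc (a := 0) (b := c) (f := fun _ : ℝ => CΔ))
    hmeas ((ae_restrict_iff' measurableSet_Ioc).2 (Eventually.of_forall fun r hr => ?_))
  exact UnboundedOperators.norm_heatExtension_le hΔ hr.1 x

/-- **`e^{hΔ}g − g = ∫₀ʰ e^{rΔ}(Δg) dr`** at every point, for `g ∈ C²` with `g`, `Dg`, `D²g`
bounded and `h > 0` (the heat equation `∂ᵣe^{rΔ}g = Δe^{rΔ}g = e^{rΔ}Δg` integrated on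
`[ε, h]`, and `ε → 0⁺` by continuity of the caloric extension at `t = 0`). [folklore] -/
theorem heatExtension_sub_self_eq_integral {g : E → F} (hg : ContDiff ℝ 2 g) {C₀ C₁ C₂ : ℝ}
    (h0 : ∀ z, ‖g z‖ ≤ C₀) (h1 : ∀ z, ‖fderiv ℝ g z‖ ≤ C₁) (h2 : ∀ z, ‖fderiv ℝ (fderiv ℝ g) z‖ ≤ C₂)
    {CΔ : ℝ} (hΔ : ∀ z, ‖(Δ g) z‖ ≤ CΔ) {h : ℝ} (hh : 0 < h) (x : E) :
    UnboundedOperators.heatExtension g h x - g x =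
      ∫ r in (0 : ℝ)..h, UnboundedOperators.heatExtension (Δ g) r x := by
  have hgm : MemLp g ∞ volume :=
    memLp_top_of_bound hg.continuous.aestronglyMeasurable C₀ (Eventually.of_forall h0)
  set f : ℝ → F := fun r => UnboundedOperators.heatExtension (Δ g) r x with hf
  have hfb : ∀ r, 0 < r → ‖f r‖ ≤ CΔ := fun r hr => UnboundedOperators.norm_heatExtension_le hΔ hr x
  have hfi : ∀ c, 0 ≤ c → IntervalIntegrable f volume 0 c := fun c hc =>
    intervalIntegrable_heatExtension_laplacian hg hΔ x hc
  -- the identity on `[ε, h]` for `0 < ε ≤ h`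
  have hE : ∀ ε, 0 < ε → ε ≤ h →
      UnboundedOperators.heatExtension g h x - UnboundedOperators.heatExtension g ε x =
        (∫ r in (0 : ℝ)..h, f r) - ∫ r in (0 : ℝ)..ε, f r := by
    intro ε hε hεh
    rw [UnboundedOperators.heatExtension_sub_eq_integral_laplacian hgm le_top hε hεh x]
    have hcongr : ∫ r in ε..h, (Δ (UnboundedOperators.heatExtension g r)) x = ∫ r in ε..h, f r := by
      refine intervalIntegral.integral_congr fun r hr => ?_
      rw [uIcc_of_le hεh] at hr
      exact UnboundedOperators.laplacian_heatExtension_of_bounded hg h0 h1 h2 (hε.trans_le hr.1) x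
    rw [hcongr, ← intervalIntegral.integral_add_adjacent_intervals (hfi ε hε.le)
      ((hfi ε hε.le).symm.trans (hfi h hh.le))]
    abel
  -- limits as `ε → 0⁺`
  have hlim1 : Tendsto (fun ε => UnboundedOperators.heatExtension g h x -
      UnboundedOperators.heatExtension g ε x) (𝓝[>] 0)
      (𝓝 (UnboundedOperators.heatExtension g h x - g x)) :=
    tendsto_const_nhds.sub (UnboundedOperators.tendsto_heatExtension_nhdsGT_zero_of_continuousAt
      hgm le_top hg.continuous.continuousAt)
  have hlim2 : Tendsto (fun ε => (∫ r in (0 : ℝ)..h, f r) - ∫ r in (0 : ℝ)..ε, f r) (𝓝[>] 0)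
      (𝓝 ((∫ r in (0 : ℝ)..h, f r) - 0)) := by
    refine tendsto_const_nhds.sub ?_
    rw [tendsto_zero_iff_norm_tendsto_zero]
    have hbound : ∀ ε, 0 < ε → ‖∫ r in (0 : ℝ)..ε, f r‖ ≤ CΔ * ε := fun ε hε => by
      have hb := intervalIntegral.norm_integral_le_of_norm_le_const (a := 0) (b := ε) (f := f)
        (C := CΔ) fun r hr => by
          rw [uIoc_of_le hε.le] at hr
          exact hfb r hr.1
      rwa [sub_zero, abs_of_pos hε] at hb
    have hup : Tendsto (fun ε : ℝ => CΔ * ε) (𝓝[>] 0) (𝓝 0) := by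
      have : Tendsto (fun ε : ℝ => CΔ * ε) (𝓝 0) (𝓝 (CΔ * 0)) :=
        tendsto_const_nhds.mul tendsto_id
      rw [mul_zero] at this
      exact this.mono_left nhdsWithin_le_nhds
    refine squeeze_zero' (Eventually.of_forall fun ε => norm_nonneg _) ?_ hup
    exact eventually_nhdsWithin_of_forall fun ε hε => hbound ε hε
  have heq : (fun ε => UnboundedOperators.heatExtension g h x - UnboundedOperators.heatExtension g ε x)
      =ᶠ[𝓝[>] 0] fun ε => (∫ r in (0 : ℝ)..h, f r) - ∫ r in (0 : ℝ)..ε, f r := by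
    filter_upwards [Ioo_mem_nhdsGT hh] with ε hε
    exact hE ε hε.1 hε.2.le
  have h := tendsto_nhds_unique (hlim1.congr' heq) hlim2
  rw [sub_zero] at h
  exact h

/-- **`‖e^{hΔ}g(x) − g(x)‖ ≤ ‖Δg‖_∞ h`** for `C²`-bounded `g` and `h > 0`. [folklore] -/
theorem norm_heatExtension_sub_self_le {g : E → F} (hg : ContDiff ℝ 2 g) {C₀ C₁ C₂ : ℝ}
    (h0 : ∀ z, ‖g z‖ ≤ C₀) (h1 : ∀ z, ‖fderiv ℝ g z‖ ≤ C₁) (h2 : ∀ z, ‖fderiv ℝ (fderiv ℝ g) z‖ ≤ C₂)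
    {CΔ : ℝ} (hΔ : ∀ z, ‖(Δ g) z‖ ≤ CΔ) {h : ℝ} (hh : 0 < h) (x : E) :
    ‖UnboundedOperators.heatExtension g h x - g x‖ ≤ CΔ * h := by
  rw [heatExtension_sub_self_eq_integral hg h0 h1 h2 hΔ hh x]
  have hb := intervalIntegral.norm_integral_le_of_norm_le_const (a := 0) (b := h)
    (f := fun r => UnboundedOperators.heatExtension (Δ g) r x) (C := CΔ) fun r hr => by
      rw [uIoc_of_le hh.le] at hr
      exact UnboundedOperators.norm_heatExtension_le hΔ hr.1 x
  rwa [sub_zero, abs_of_pos hh] at hb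

end HeatIncrement

/-! ### The level tensors of a `Cᵏ⁺³` slice as a directional chain -/

section Chain

variable {W : E → E} {k : ℕ} {A : ℝ}

omit [MeasurableSpace E] [BorelSpace E] in
/-- Powers of two are monotone: `2ᵏ⁺ⁱ ≤ 2ᵏ⁺³` for `i ≤ 3` (real form used for the bounds).
[folklore] -/
theorem two_pow_le_two_pow_add_three {i : ℕ} (hi : i ≤ 3) (k : ℕ) :
    (2 : ℝ) ^ (k + i) ≤ 2 ^ (k + 3) :=
  pow_le_pow_right₀ (by norm_num) (by omega)

omit [MeasurableSpace E] [BorelSpace E] in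
/-- **The level tensors of a `Cᵏ⁺³` slice form a directional chain bounded by
`2ᵏ⁺³A²∏‖mᵢ‖`**: with `P = WⱼWₗ`, the functions `Dᵏ P·m`, `Dᵏ⁺¹P·(w, m)`, `Dᵏ⁺²P·(v, w, m)`,
`Dᵏ⁺³P·(u, v, w, m)` are successive directional derivatives, the first three are `C¹`, and
all are bounded by `2ᵏ⁺³A²∏‖mᵢ‖` at vectors of norm `≤ 1` (`levelTensor_contDiff_one`,
`abs_levelTensor_le`). [folklore] -/
theorem levelTensor_chain (hW : ContDiff ℝ (k + 3) W) (hA : 0 ≤ A)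
    (hbd : ∀ i ≤ k + 3, ∀ y, ‖iteratedFDeriv ℝ i W y‖ ≤ A) (m : Fin k → E)
    (j l : Fin (Module.finrank ℝ E)) :
    let P : E → ℝ := fun y => ⟪W y, stdOrthonormalBasis ℝ E j⟫ * ⟪W y, stdOrthonormalBasis ℝ E l⟫
    ContDiff ℝ 1 (fun y => iteratedFDeriv ℝ k P y m) ∧
    (∀ y, |iteratedFDeriv ℝ k P y m| ≤ 2 ^ (k + 3) * A ^ 2 * ∏ i, ‖m i‖) ∧
    (∀ w, ContDiff ℝ 1 (fun y => iteratedFDeriv ℝ (k + 1) P y (Fin.cons w m))) ∧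
    (∀ w y, fderiv ℝ (fun y => iteratedFDeriv ℝ k P y m) y w =
      iteratedFDeriv ℝ (k + 1) P y (Fin.cons w m)) ∧
    (∀ w, ‖w‖ ≤ 1 → ∀ y, |iteratedFDeriv ℝ (k + 1) P y (Fin.cons w m)| ≤
      2 ^ (k + 3) * A ^ 2 * ∏ i, ‖m i‖) ∧
    (∀ v w, ContDiff ℝ 1 (fun y => iteratedFDeriv ℝ (k + 2) P y (Fin.cons v (Fin.cons w m)))) ∧
    (∀ v w y, fderiv ℝ (fun y => iteratedFDeriv ℝ (k + 1) P y (Fin.cons w m)) y v =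
      iteratedFDeriv ℝ (k + 2) P y (Fin.cons v (Fin.cons w m))) ∧
    (∀ v w, ‖v‖ ≤ 1 → ‖w‖ ≤ 1 → ∀ y, |iteratedFDeriv ℝ (k + 2) P y (Fin.cons v (Fin.cons w m))| ≤
      2 ^ (k + 3) * A ^ 2 * ∏ i, ‖m i‖) ∧
    (∀ u v w y, fderiv ℝ (fun y => iteratedFDeriv ℝ (k + 2) P y (Fin.cons v (Fin.cons w m))) y u =
      iteratedFDeriv ℝ (k + 3) P y (Fin.cons u (Fin.cons v (Fin.cons w m)))) ∧
    (∀ u v w, ‖u‖ ≤ 1 → ‖v‖ ≤ 1 → ‖w‖ ≤ 1 → ∀ y,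
      |iteratedFDeriv ℝ (k + 3) P y (Fin.cons u (Fin.cons v (Fin.cons w m)))| ≤
        2 ^ (k + 3) * A ^ 2 * ∏ i, ‖m i‖) := by
  intro P
  set B : ℝ := 2 ^ (k + 3) * A ^ 2 * ∏ i, ‖m i‖ with hB
  have hP0 : 0 ≤ ∏ i, ‖m i‖ := Finset.prod_nonneg fun i _ => norm_nonneg _
  -- smoothness at the three levels
  have hW1 : ContDiff ℝ (k + 1) W := hW.of_le (by exact_mod_cast (by omega : k + 1 ≤ k + 3))
  have hW2 : ContDiff ℝ (k + 1 + 1) W := hW.of_le (by exact_mod_cast (by omega : k + 1 + 1 ≤ k + 3))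
  have hW3 : ContDiff ℝ (k + 2 + 1) W := hW.of_le (by exact_mod_cast (by omega : k + 2 + 1 ≤ k + 3))
  have hb1 : ∀ i ≤ k + 1, ∀ y, ‖iteratedFDeriv ℝ i W y‖ ≤ A := fun i hi y => hbd i (by omega) y
  have hb2 : ∀ i ≤ k + 1 + 1, ∀ y, ‖iteratedFDeriv ℝ i W y‖ ≤ A := fun i hi y => hbd i (by omega) y
  have hb3 : ∀ i ≤ k + 2 + 1, ∀ y, ‖iteratedFDeriv ℝ i W y‖ ≤ A := fun i hi y => hbd i (by omega) y
  have hL0 := levelTensor_contDiff_one hW1 hA hb1 j l m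
  have hL1 := fun w => levelTensor_contDiff_one hW2 hA hb2 j l (Fin.cons w m)
  have hL2 := fun v w => levelTensor_contDiff_one hW3 hA hb3 j l (Fin.cons v (Fin.cons w m))
  -- bounds at the four levels
  have hWk : ContDiff ℝ k W := hW.of_le (by exact_mod_cast (by omega : k ≤ k + 3))
  have hWk1 : ContDiff ℝ (k + 1) W := hW1
  have hWk2 : ContDiff ℝ (k + 2) W := hW.of_le (by exact_mod_cast (by omega : k + 2 ≤ k + 3))
  have hbk : ∀ i ≤ k, ∀ y, ‖iteratedFDeriv ℝ i W y‖ ≤ A := fun i hi y => hbd i (by omega) y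
  have hbk2 : ∀ i ≤ k + 2, ∀ y, ‖iteratedFDeriv ℝ i W y‖ ≤ A := fun i hi y => hbd i (by omega) y
  have hA2 : 0 ≤ A ^ 2 := sq_nonneg A
  have e0 : ∀ y, |iteratedFDeriv ℝ k P y m| ≤ B := fun y => by
    refine (abs_levelTensor_le hWk hA hbk j l m y).trans ?_
    have := two_pow_le_two_pow_add_three (i := 0) (by norm_num) k
    rw [add_zero] at this
    exact mul_le_mul_of_nonneg_right (mul_le_mul_of_nonneg_right this hA2) hP0
  have e1 : ∀ w, ‖w‖ ≤ 1 → ∀ y, |iteratedFDeriv ℝ (k + 1) P y (Fin.cons w m)| ≤ B := fun w hw y => by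
    refine (abs_levelTensor_le hWk1 hA hb1 j l (Fin.cons w m) y).trans ?_
    rw [prod_norm_cons]
    have h2 := two_pow_le_two_pow_add_three (i := 1) (by norm_num) k
    calc 2 ^ (k + 1) * A ^ 2 * (‖w‖ * ∏ i, ‖m i‖) ≤ 2 ^ (k + 3) * A ^ 2 * (1 * ∏ i, ‖m i‖) := by
          gcongr
      _ = B := by rw [hB, one_mul]
  have e2 : ∀ v w, ‖v‖ ≤ 1 → ‖w‖ ≤ 1 → ∀ y,
      |iteratedFDeriv ℝ (k + 2) P y (Fin.cons v (Fin.cons w m))| ≤ B := fun v w hv hw y => by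
    refine (abs_levelTensor_le hWk2 hA hbk2 j l (Fin.cons v (Fin.cons w m)) y).trans ?_
    rw [prod_norm_cons, prod_norm_cons]
    have h2 := two_pow_le_two_pow_add_three (i := 2) (by norm_num) k
    calc 2 ^ (k + 2) * A ^ 2 * (‖v‖ * (‖w‖ * ∏ i, ‖m i‖))
        ≤ 2 ^ (k + 3) * A ^ 2 * (1 * (1 * ∏ i, ‖m i‖)) := by gcongr
      _ = B := by rw [hB, one_mul, one_mul]
  have e3 : ∀ u v w, ‖u‖ ≤ 1 → ‖v‖ ≤ 1 → ‖w‖ ≤ 1 → ∀ y,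
      |iteratedFDeriv ℝ (k + 3) P y (Fin.cons u (Fin.cons v (Fin.cons w m)))| ≤ B :=
    fun u v w hu hv hw y => by
    refine (abs_levelTensor_le hW hA hbd j l (Fin.cons u (Fin.cons v (Fin.cons w m))) y).trans ?_
    rw [prod_norm_cons, prod_norm_cons, prod_norm_cons]
    calc 2 ^ (k + 3) * A ^ 2 * (‖u‖ * (‖v‖ * (‖w‖ * ∏ i, ‖m i‖)))
        ≤ 2 ^ (k + 3) * A ^ 2 * (1 * (1 * (1 * ∏ i, ‖m i‖))) := by gcongr
      _ = B := by rw [hB, one_mul, one_mul, one_mul]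
  exact ⟨hL0.1, e0, fun w => (hL1 w).1, fun w y => hL0.2.1 y w, e1, fun v w => (hL2 v w).1,
    fun v w y => (hL1 w).2.1 y v, e2, fun u v w y => (hL2 v w).2.1 y u, e3⟩

variable (hE : Module.finrank ℝ E = 3)
include hE

/-- **The level-`k` Oseen integrand of a `Cᵏ⁺³` slice is bounded uniformly in the clock**:
`‖∑ᵢ 𝒩_τ[Tₖᵐ]ᵢ(x) eᵢ‖ ≤ 26253 · 2ᵏ⁺³A²∏‖mᵢ‖` for every `τ > 0`. [folklore] -/
theorem norm_sum_oseenHeat_levelTensor_smul_le_uniform (hW : ContDiff ℝ (k + 3) W) (hA : 0 ≤ A)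
    (hbd : ∀ i ≤ k + 3, ∀ y, ‖iteratedFDeriv ℝ i W y‖ ≤ A) (m : Fin k → E) {τ : ℝ} (hτ : 0 < τ)
    (x : E) :
    ‖∑ i, oseenHeat τ (fun j l y => iteratedFDeriv ℝ k
        (fun y => ⟪W y, stdOrthonormalBasis ℝ E j⟫ * ⟪W y, stdOrthonormalBasis ℝ E l⟫) y m) i x •
        stdOrthonormalBasis ℝ E i‖ ≤
      26253 * (2 ^ (k + 3) * A ^ 2 * ∏ i, ‖m i‖) := by
  have hc := fun j l => levelTensor_chain hW hA hbd m j l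
  exact norm_sum_oseenHeat_smul_le_of_chain hE
    (G₁ := fun j l w y => iteratedFDeriv ℝ (k + 1)
      (fun y => ⟪W y, stdOrthonormalBasis ℝ E j⟫ * ⟪W y, stdOrthonormalBasis ℝ E l⟫) y (Fin.cons w m))
    (G₂ := fun j l v w y => iteratedFDeriv ℝ (k + 2)
      (fun y => ⟪W y, stdOrthonormalBasis ℝ E j⟫ * ⟪W y, stdOrthonormalBasis ℝ E l⟫) y
        (Fin.cons v (Fin.cons w m)))
    (G₃ := fun j l u v w y => iteratedFDeriv ℝ (k + 3)
      (fun y => ⟪W y, stdOrthonormalBasis ℝ E j⟫ * ⟪W y, stdOrthonormalBasis ℝ E l⟫) y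
        (Fin.cons u (Fin.cons v (Fin.cons w m))))
    (fun j l => (hc j l).1) (fun j l => (hc j l).2.1) (fun j l => (hc j l).2.2.1)
    (fun j l => (hc j l).2.2.2.1) (fun j l => (hc j l).2.2.2.2.1) (fun j l => (hc j l).2.2.2.2.2.1)
    (fun j l => (hc j l).2.2.2.2.2.2.1) (fun j l => (hc j l).2.2.2.2.2.2.2.1)
    (fun j l => (hc j l).2.2.2.2.2.2.2.2.1) (fun j l => (hc j l).2.2.2.2.2.2.2.2.2)
    (by positivity) hτ x

end Chain

/-! ### The clause (4.11): Lipschitz dependence of `DᵏV` on time -/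

section TimeLipschitz

variable (hE : Module.finrank ℝ E = 3)
include hE

/-- **KNSS (4.11) for bounded mild solutions, in the tree's rendering**: for every order `k` and
every `δ > 0` there is `L = L_k(δ)` (depending on `k, N, T, δ` only) such that for every `V` with
`IsKNSSDriftMild T N V 0`, `‖DᵏV(t)(x) − DᵏV(s)(x)‖ ≤ L|t − s|` for all `s, t ∈ [δ, T)` and
all `x`. By the order-`k` identity between `s < t` the increment is `[e^{(t−s)Δ}g − g] −
∫ₛᵗ ∑ᵢ 𝒩_{t−σ}[Tₖᵐ(σ)]ᵢ eᵢ dσ`, `g = DᵏV(s)·m`: the first term is at most `3C(t − s)∏‖mᵢ‖`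
(`norm_heatExtension_sub_self_le` with `‖Δg‖ ≤ 3C∏‖mᵢ‖`), the second at most
`26253 · 2ᵏ⁺³C²(t − s)∏‖mᵢ‖` (the clock-uniform Oseen bound on `C³`-bounded level tensors), with
`C = C_{k+3}(δ)` from `level_all`. [cite: KochNadirashviliSereginSverak2009, §4 (4.11) with §3 (3.14) (arXiv:0709.3599v1 pp. 6–8)] -/
theorem exists_lipschitz_time_iteratedFDeriv {T N : ℝ} (k : ℕ) {δ : ℝ} (hδ : 0 < δ) :
    ∃ L : ℝ, 0 ≤ L ∧ ∀ ⦃V : ℝ → E → E⦄, IsKNSSDriftMild T N V 0 →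
      ∀ s ∈ Ico δ T, ∀ t ∈ Ico δ T, ∀ x,
        ‖iteratedFDeriv ℝ k (V t) x - iteratedFDeriv ℝ k (V s) x‖ ≤ L * |t - s| := by
  obtain ⟨C, hC0, hCV⟩ := level_all hE (T := T) (N := N) (k + 3)
  obtain ⟨Ck, -, hCVk⟩ := level_all hE (T := T) (N := N) k
  set A : ℝ := C δ with hA
  have hA0 : 0 ≤ A := hC0 δ hδ
  set L : ℝ := 3 * A + 26253 * (2 ^ (k + 3) * A ^ 2) with hL
  refine ⟨L, by positivity, fun V hV => ?_⟩
  obtain ⟨hsm, hbd, -, -⟩ := hCV hV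
  obtain ⟨-, -, hid, -⟩ := hCVk hV
  -- the one-sided statement
  have key : ∀ s ∈ Ico δ T, ∀ t ∈ Ico δ T, s < t → ∀ x,
      ‖iteratedFDeriv ℝ k (V t) x - iteratedFDeriv ℝ k (V s) x‖ ≤ L * (t - s) := by
    intro s hs t ht hst x
    have hs0 : 0 < s := hδ.trans_le hs.1
    have hsT : s ∈ Ioo 0 T := ⟨hs0, hs.2⟩
    have hts : 0 < t - s := sub_pos.2 hst
    refine ContinuousMultilinearMap.opNorm_le_bound (by positivity) fun m => ?_
    set P : ℝ := ∏ i, ‖m i‖ with hP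
    have hP0 : 0 ≤ P := Finset.prod_nonneg fun i _ => norm_nonneg _
    -- the caloric datum `g = DᵏV(s)·m` is `C²`-bounded
    have hfs : ContDiff ℝ (k + 2) (V s) := (hsm s hsT).of_le (by exact_mod_cast (by omega : k + 2 ≤ k + 3))
    have hbds : ∀ j ≤ k + 2, ∀ y, ‖iteratedFDeriv ℝ j (V s) y‖ ≤ A := fun j hj y =>
      hbd δ hδ j (by omega) s hs y
    obtain ⟨hg2, hg0, -, hg1, -, hg2', hgΔ⟩ := evalData_bounds hfs hA0 hbds m
    rw [hE] at hgΔ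
    have hgΔ' : ∀ y, ‖(Δ (fun y => iteratedFDeriv ℝ k (V s) y m)) y‖ ≤ 3 * (A * P) := by
      intro y; have := hgΔ y; push_cast at this; exact this
    have hTA : ‖UnboundedOperators.heatExtension (fun y => iteratedFDeriv ℝ k (V s) y m) (t - s) x -
        iteratedFDeriv ℝ k (V s) x m‖ ≤ 3 * (A * P) * (t - s) :=
      norm_heatExtension_sub_self_le hg2 hg0 hg1 hg2' hgΔ' hts x
    -- the Duhamel term
    have hTB : ‖∫ σ in s..t, ∑ i, oseenHeat (t - σ)
        (fun j l y => iteratedFDeriv ℝ k (driftTensor V 0 σ j l) y m) i x • stdOrthonormalBasis ℝ E i‖ ≤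
        26253 * (2 ^ (k + 3) * A ^ 2 * P) * (t - s) := by
      have hb := intervalIntegral.norm_integral_le_of_norm_le (μ := volume) hst.le
        (f := fun σ => ∑ i, oseenHeat (t - σ)
          (fun j l y => iteratedFDeriv ℝ k (driftTensor V 0 σ j l) y m) i x • stdOrthonormalBasis ℝ E i)
        (g := fun _ => 26253 * (2 ^ (k + 3) * A ^ 2 * P))
        (ae_mem_Ioc_of_forall_Ioo fun σ hσ => ?_) intervalIntegrable_const
      · rw [intervalIntegral.integral_const, smul_eq_mul] at hb
        linarith [hb]
      · have hσT : σ ∈ Ioo 0 T := ⟨hs0.trans hσ.1, hσ.2.trans ht.2⟩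
        have hσδ : σ ∈ Ico δ T := ⟨hs.1.trans hσ.1.le, hσT.2⟩
        simp only [driftTensor_zero_eq]
        exact norm_sum_oseenHeat_levelTensor_smul_le_uniform hE (hsm σ hσT) hA0
          (fun i hi y => hbd δ hδ i hi σ hσδ y) m (sub_pos.2 hσ.2) x
    -- assemble through the identity (iii)ₖ
    rw [sub_apply, hid m s t hs0 hst ht.2 x]
    have e : UnboundedOperators.heatExtension (fun y => iteratedFDeriv ℝ k (V s) y m) (t - s) x -
        (∫ σ in s..t, ∑ i, oseenHeat (t - σ)
          (fun j l y => iteratedFDeriv ℝ k (driftTensor V 0 σ j l) y m) i x • stdOrthonormalBasis ℝ E i) -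
        iteratedFDeriv ℝ k (V s) x m =
        (UnboundedOperators.heatExtension (fun y => iteratedFDeriv ℝ k (V s) y m) (t - s) x -
          iteratedFDeriv ℝ k (V s) x m) -
        ∫ σ in s..t, ∑ i, oseenHeat (t - σ)
          (fun j l y => iteratedFDeriv ℝ k (driftTensor V 0 σ j l) y m) i x • stdOrthonormalBasis ℝ E i := by
      abel
    rw [e]
    calc _ ≤ 3 * (A * P) * (t - s) + 26253 * (2 ^ (k + 3) * A ^ 2 * P) * (t - s) :=
          (norm_sub_le _ _).trans (add_le_add hTA hTB)
      _ = L * (t - s) * P := by rw [hL]; ring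
  -- symmetry in `s, t`
  intro s hs t ht x
  rcases lt_trichotomy s t with hst | hst | hst
  · rw [abs_of_pos (sub_pos.2 hst)]; exact key s hs t ht hst x
  · subst hst; simp
  · rw [norm_sub_rev, abs_sub_comm, abs_of_pos (sub_pos.2 hst)]; exact key t ht s hs hst x

/-- **Continuity in time of the `x`-derivatives** at a fixed point: `τ ↦ DᵏV(τ)(x)` is
continuous on `(0, T)` (locally Lipschitz). [folklore] -/
theorem continuousOn_time_iteratedFDeriv {T N : ℝ} {V : ℝ → E → E} (hV : IsKNSSDriftMild T N V 0)
    (k : ℕ) (x : E) : ContinuousOn (fun τ => iteratedFDeriv ℝ k (V τ) x) (Ioo 0 T) := by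
  intro τ hτ
  obtain ⟨L, hL0, hLV⟩ := exists_lipschitz_time_iteratedFDeriv hE (T := T) (N := N) k (half_pos hτ.1)
  have hlip := hLV hV
  rw [Metric.continuousWithinAt_iff]
  intro ε hε
  refine ⟨min (τ / 2) (ε / (L + 1)), lt_min (half_pos hτ.1) (by positivity), fun σ hσ hd => ?_⟩
  rw [dist_eq_norm]
  have hd' : |σ - τ| < min (τ / 2) (ε / (L + 1)) := by rwa [Real.dist_eq] at hd
  have hσδ : σ ∈ Ico (τ / 2) T := by
    refine ⟨?_, hσ.2⟩
    have := (abs_lt.1 (hd'.trans_le (min_le_left _ _))).1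
    linarith
  have hτδ : τ ∈ Ico (τ / 2) T := ⟨by linarith [hτ.1], hτ.2⟩
  calc ‖iteratedFDeriv ℝ k (V σ) x - iteratedFDeriv ℝ k (V τ) x‖ ≤ L * |σ - τ| := hlip τ hτδ σ hσδ x
    _ ≤ L * (ε / (L + 1)) := mul_le_mul_of_nonneg_left (hd'.le.trans (min_le_right _ _)) hL0
    _ < ε := by
        rw [mul_div_assoc']
        rw [div_lt_iff₀ (by positivity)]
        nlinarith

/-- **Joint continuity of `(τ, x) ↦ DᵏV(τ)(x)` on `(0, T) × E`** (continuity in `x` of the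
smooth slices plus the Lipschitz bound in time, uniform in `x`, on every `[δ, T)`). [folklore] -/
theorem continuousOn_uncurry_iteratedFDeriv {T N : ℝ} {V : ℝ → E → E} (hV : IsKNSSDriftMild T N V 0)
    (k : ℕ) : ContinuousOn (fun p : ℝ × E => iteratedFDeriv ℝ k (V p.1) p.2) (Ioo 0 T ×ˢ univ) := by
  rintro ⟨τ, x⟩ hp
  have hτ : τ ∈ Ioo 0 T := (mem_prod.1 hp).1
  obtain ⟨L, -, hLV⟩ := exists_lipschitz_time_iteratedFDeriv hE (T := T) (N := N) k (half_pos hτ.1)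
  have hcont : ∀ σ ∈ Ioo (τ / 2) T, Continuous fun y => iteratedFDeriv ℝ k (V σ) y := fun σ hσ =>
    (contDiff_slice hE hV ⟨(half_pos hτ.1).trans hσ.1, hσ.2⟩).continuous_iteratedFDeriv
      (by exact_mod_cast le_top)
  have hj : ContinuousOn (uncurry fun σ y => iteratedFDeriv ℝ k (V σ) y) (Ioo (τ / 2) T ×ˢ univ) :=
    continuousOn_uncurry_of_lipschitz_time hcont (L := L) fun σ hσ σ' hσ' z =>
      hLV hV σ' ⟨hσ'.1.le, hσ'.2⟩ σ ⟨hσ.1.le, hσ.2⟩ z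
  have hmem : Ioo (τ / 2) T ×ˢ (univ : Set E) ∈ 𝓝[Ioo 0 T ×ˢ univ] (τ, x) :=
    mem_nhdsWithin_of_mem_nhds ((isOpen_Ioo.prod isOpen_univ).mem_nhds
      (mk_mem_prod ⟨half_lt_self hτ.1, hτ.2⟩ (mem_univ x)))
  exact (hj (τ, x) (mk_mem_prod ⟨half_lt_self hτ.1, hτ.2⟩ (mem_univ x))).mono_of_mem_nhdsWithin hmem

end TimeLipschitz



end KNSSBootstrap

end Literature.Analysis.FluidPDE

end
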